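import Summits.Parity.GeneralizedHardyLittlewood.Theorems.PrimeLevelFamEdgeIdeaDeltasPairsSplit
import Literature.NumberTheory.LFunctions.KowalskiMichelPeterssonFormula
import HarnessLib

/-!
# Route `PrimeLevelFamEdge` — TYPED IDEA DELTAS, deck 21a: `decomp` lens — K-L17-2 «PETERSSON LAYERS» v3, the SPLIT of
# K_A along the Petersson MODULUS `c = q·r` (§1 AFE weights · §2 spectral sum / diagonal / layers / heart / tail · §3 piece
# statements · §4 four-piece glue).  Decks 21b (§5 rung + upper, §5b far layers / Weil cut / six-split) and 21c (§5c the
# THREE-BAND HEART / seven-split, §6 costume-test witnesses) continue this file.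
# LANDING NOTE (typer ls-idea-typ-1 gen 3, cell ls-idea): the seat's sorry-free twin `Split_PeterssonLayers.v3.lean` sha16
# 90790e3a81ab6eae (seat ls-idea-lens-17 gen 3; = the registered D-0145 line `Cruxes/MomentsBeyondDiagonal/Lines/petersson_layers.lean`
# v3 commit 6a811dbad7cc minus its §7 stubs; critic E b7/b9 PASS as SPLIT/SEAM, v3 content to mark by E successor) VERBATIM up to
# (i) the namespace `…Cruxes.MomentsBeyondDiagonal.PeterssonLayers` → `…Theorems.PrimeLevelFamEdgeIdeaDeltas.PeterssonLayers`,
# (ii) the three-file cut for the 400-line rule, (iii) this header.  The registered stubs (stub_first/diag/rung/core/band/identP/farP)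
# live ONLY in the Cruxes line; nothing here is a stub or closes one.

# namespace so that it is byte-comparable with the registered line). Seat ls-idea-lens-17 gen 3, 2026-08-28. No summit statement is proved.

THE SEAM (KMV 2000 §5 read to the letter; every identity below is PRINTED, none is proved here and none is a
hypothesis of the glue).  At prime level `q`, weight 2, mollifier length `M = q̂^{Δ'}`:
* (AFE, KMV (21)–(22) p. 12 with the exact weights kept: «The functional equation for Λ(f,1/2+s) has always sign +1
  so … Λ^{(k)}(f,1/2)² = 2q̂ Σ_{n₁,n₂} λ_f(n₁)λ_f(n₂)(n₁n₂)^{−1/2} (1/2πi)∫_{(3)} (q̂ᵗΓ(1+t)n₁^{−t})^{(k)}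
  (q̂ᵗΓ(1+t)n₂^{−t})^{(k)} dt/t»; for two orders `i, j`: `Λ^{(i)}(f,½)Λ^{(j)}(f,½) = (1+(−1)^{i+j}) q̂ Σ_{n₁,n₂≥1}
  λ_f(n₁)λ_f(n₂)(n₁n₂)^{−1/2} W_{ij}(q̂;n₁,n₂)`, `W_{ij}` = `afeW` below (same contour `Re t = 3`, `G ≡ 1`);
  `λ_f`, `Λ^{(j)}(f,½)` are REAL (p. 4: «the Λ^{(k)}(f,1/2) are all real»), so `|Q̃Λ(f) M_P(f)|² = Q̃Λ(f)² M_P(f)²`);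
* (Hecke, KMV Lemma 3.1 (10) p. 8: «λ_f(m)λ_f(n) = Σ_{d|(m,n)} ε_q(d) λ_f(mn/d²)», `ε_q(d) = 1` for `d ≤ m < M < q`;
  p. 13: «since q, the level, is prime, and we have the restriction m₁, m₂ < M … the trivial character ε_q won't
  appear»), pairing `mᵢ` with `nᵢ` as on p. 13;
* (Petersson WITH its Kloosterman–Bessel series, KMV Lemma 3.2 (11) p. 8 = the tree's named fact
  `KowalskiMichel2000.kowalskiMichel2000_peterssonFormula`: `Σʰ λ_f(a)λ_f(b) = δ(a,b) − J(a,b)`,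
  `J(a,b) = (2π/q) Σ_{r≥1} r⁻¹ S(a,b;qr) J₁(4π√(ab)/(qr))` = `petJ q a b = (2π/q) Σ' r, petKloostermanTerm q a b r`),
one has, to a super-polynomially small AFE-truncation error (the weights satisfy `W ≪_A (q̂²/(n₁n₂))^A` for every
`A`, p. 12 «decays faster than any negative power of y»; the n-box below is `nᵢ ≤ q²`),

  `Q^h(P,Q)(q̂^{Δ'}) = D − Σ_{r ≥ 1} K_r`,   `D = diagPart`,  `K_r = layer r` (the Petersson MODULUS `c = q·r`).

Here `D` and every `K_r` are EXPLICIT FINITE SUMS over `(i, j, n₁, n₂, m₁, m₂, d₁, d₂)` of Möbius × `ψ⁻¹` × `P` ×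
Mellin weight × (Kronecker delta | `r⁻¹ S(a,b;qr) J₁(4π√(ab)/(qr))`), `a = m₁n₁/d₁²`, `b = m₂n₂/d₂²` — they contain
NO cusp form, NO `L`-function and NO harmonic weight: the split DE-AUTOMORPHISES the second display.

THE CUT.  For a layer-cut exponent `ρ : ℝ → ℝ`: HEART `= Σ_{1 ≤ r ≤ q̂^{ρ(Δ')}} K_r` (explicit), TAIL
`:= Q^h − D + HEART` (DEFINED as the difference, so that `Q^h = D − HEART + TAIL` is an identity of complex numbers
and the glue needs none of the three printed identities; by them TAIL `= −Σ_{r > q̂^{ρ}} K_r` + the AFE-truncation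
error).  v1 instance `ρ⋆(Δ') = 3(Δ' − 1)` (heart cut); instance of record since §5b: the Weil cut `ρ_W = 4Δ' − 3/2`:
* the Bessel argument in layer `r` is `x = 4π√(ab)/(qr) ≍ q̂^{Δ'−1}/r` at the top pairs, so the OSCILLATORY layers
  (`x ≳ 1`) are `r ≲ q̂^{Δ'−1}` — EMPTY below the diagonal (`Δ' < 1`: then also `⌊q̂^{ρ⋆}⌋ = 0`, HEART `= 0`): the
  heart is exactly what is new beyond `Δ' = 1`; KMV's whole §5 off-diagonal analysis (Lemma 3.3, hypothesis
  `m₁m₂ ≪ q^{1−δ}` ⇔ `x ≤ q^{−δ/2}` in EVERY layer) is a small-argument analysis;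
* (A)-CONSISTENCY (barrier-notes BN-7a WALL OF RECORD (T3), HOME ls-idea-ref-2 l.88): in the exceptional world the
  moduli `q·r`, `r ∈ Dℕ`, carry a diagonal-size `χ_D`-structured term exactly when `Δ' > c₀ = 1 + 2 log D/log q`
  ⇔ `D < q̂^{Δ'−1}` ⇔ the resonant layers lie in the HEART; the layer `r = 1` (modulus `q`, the «c = q term») is
  the `χ_D`-FREE technology RUNG of (T4) (GRH(χ mod q)-feasible per KMV p. 28 L71–77 [I-S], `ζ`-immune) — §5 below
  cuts the heart once more into RUNG (`r = 1`) + UPPER LAYERS (`2 ≤ r ≤ q̂^{ρ}`), glue proved;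
* TAIL — ERRATUM OF RECORD (gen 2, §5b THE COUNT): under fixed-pair technology (Weil; Poisson + divisor counting =
  the METHOD of Lemma 3.3) the deficit against `q̂ log⁻³ q̂` is `q̂^{2(Δ'−1)}` FLAT over `q̂^{Δ'−1} ≤ r ≤ q̂²`, then
  `q̂^{2Δ'−1} r^{−1/2}`, reaching `1` only at `r = q̂^{4Δ'−2}`; the PROVABLE tail instance is the WEIL CUT
  `ρ_W(Δ') = 4Δ' − 3/2` (§5b: `TailNearFar ρ_W` identification + explicit `SubFar ρ_W`, P-E7-1); the v1 instance
  `ρ⋆(Δ') = 3(Δ'−1)` stays a checked corollary but its v1 gloss «layer-scaled image of KMV's printed regime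
  `½ ≤ Δ < 1`, Lemma-3.3 method with the `1/r` gain of `J₁`» is RETRACTED (the `1/r` is already inside both counts;
  [VdK2] = VanderKam, JLMS 61 (2000), acq-13804, NOT held). The glue is proved for EVERY `ρ`.
So: SubDiag (M/L: residues (23)–(28) with the extra constraint `m₁m₂ ≲ q̂²` beyond the diagonal — the functional
`t_D` is NOT `secondMomentForm` continued, hence `∃ t_D`), SubTail (at `ρ_W`: L identification + M explicit far layers, §5b; at any lower cut it contains wall), SubHeart (XL: the
localized wall of BN-7a — «beat the ℓ²/Pólya–Vinogradov bound for the μ∗μ-weighted bilinear Kloosterman form at ONE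
prime modulus and its first `q̂^{ρ}` multiples» — now a statement about explicit exponential sums; deck 13's
`Barrier.toyCq` is its GL(1) toy (sharp cut-off, no `J₁`, `r = 1`)).

PROVED here (no `sorry`, axioms ⊆ {propext, Classical.choice, Quot.sound}): the identity `QhPQ = diagPart − heart ρ +
tail ρ`, the glue `MomentsBeyondDiagonal_of_layerSplit ρ : SubFirst → SubDiag → SubHeart ρ → SubTail ρ → K_A` for every
`ρ` (windows intersected, `T₂ := t_D − t_H + t_T − secondMomentForm`, constants added), its instance at `ρ⋆`, the
heart's own split `SubRung → SubUpper ρ → SubHeart ρ` (for `ρ ≥ 0` on `(1, ∞)`), the §5b tail split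
`TailNearFar ρ → SubFar ρ → SubTail ρ` (perturbation + negation) with the six-piece glue
`MomentsBeyondDiagonal_of_sixSplitWeil : SubFirst → SubDiag → SubRung → SubUpper ρ_W → TailNearFar ρ_W → SubFar ρ_W → K_A`,
and the costume-test witnesses of §6
(the EMPTY cut's heart is provable outright; at the empty cut the split degenerates to DIAGONAL / OFF-DIAGONAL and
still implies K_A with `SubFirst`, `SubDiag`).  `SubFirst` is deck 15's, BY NAME.
NOT proved: any piece; the three printed identities (docstring only; the AFE is not yet a named fact of the tree —
typing want W-L17-2 = F-AFE2 + F-HECKE, card K-L17-2 §10(h)). No exceptional-zero theorem (no Landau–Siegel / Siegel-zero exclusion, no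
Theorem 1–2 of arXiv:2211.02515, no repaired Margin232) is proved by ideation; typed ≠ proved; computed ≠ proved.
-/

noncomputable section

open scoped MatrixGroups Real
open CongruenceSubgroup Complex Finset Polynomial MeasureTheory
open Literature.NumberTheory.EllipticCurves.ModularForms
open Literature.NumberTheory.LFunctions

namespace Summit.Parity.GeneralizedHardyLittlewood.Theorems.PrimeLevelFamEdgeIdeaDeltas.PeterssonLayers

open Summit.Parity.GeneralizedHardyLittlewood.Theses.PrimeLevelFamEdge
open Summit.Parity.GeneralizedHardyLittlewood.Theorems.PrimeLevelFamEdgeIdeaDeltas.PairsSplit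
  (FirstMomentBeyond SubFirst subFirst_of_momentsBeyondDiagonal)

/-- Local alias of the route crux `PrimeLevelFamEdge.MomentsBeyondDiagonal` (K_A). Every intermediate glue theorem below
concludes `KA`; ONLY the registered composition `MomentsBeyondDiagonal_of` (§7) concludes the crux BY NAME — the
registered-skeleton convention of `Lines/pairs_beyond_family_size.lean` (`ledger skeleton check` takes the first theorem
concluding the crux as the skeleton). `KA` unfolds to the crux definitionally. -/
def KA : Prop := MomentsBeyondDiagonal

/-! ## §1. The exact AFE weight of the product `Λ^{(i)}(f,½) Λ^{(j)}(f,½)` (KMV (21)–(22), contour `Re t = 3`) -/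

/-- `D_i(q̂; n, s) := ∂ⁱ/∂sⁱ [ q̂ˢ Γ(1+s) n^{−s} ]` — the `i`-th `s`-derivative of the `n`-th summand kernel of
`Λ(f, ½+s) = q̂^{1/2} Σ_n λ_f(n) n^{−1/2} · q̂ˢ Γ(1+s) n^{−s}` (KMV p. 9 display before (14), squared on p. 12). -/
def afeKernel (qh : ℝ) (i n : ℕ) (s : ℂ) : ℂ :=
  iteratedDeriv i (fun s : ℂ ↦ ((qh : ℂ) ^ s) * Complex.Gamma (1 + s) * ((n : ℂ) ^ (-s))) s

/-- **`W_{ij}(q̂; n₁, n₂) := (1/2πi) ∫_{(3)} D_i(q̂;n₁,t) D_j(q̂;n₂,t) dt/t`** `= (1/2π) ∫_ℝ D_i(3+iy) D_j(3+iy) (3+iy)⁻¹ dy`,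
so that for `f ∈ S₂(q)^*` and `i + j` even `Λ^{(i)}(f,½)Λ^{(j)}(f,½) = 2 q̂ Σ_{n₁,n₂≥1} λ_f(n₁)λ_f(n₂)(n₁n₂)^{−1/2}
W_{ij}(q̂;n₁,n₂)` (KMV (21): `i = j = k`; for `i + j` odd the product vanishes by the sign of the functional
equation, matching the factor `1 + (−1)^{i+j}` used below). At `i = j = 0`, `W₀₀ = W(n₁n₂/q̂²)` of (22). -/
def afeW (qh : ℝ) (i j n₁ n₂ : ℕ) : ℂ :=
  (1 / (2 * π) : ℂ) * ∫ y : ℝ, afeKernel qh i n₁ (3 + y * I) * afeKernel qh j n₂ (3 + y * I) / (3 + y * I)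

/-! ## §2. The spectral sum against a pair kernel, the diagonal, the layers, the heart and the tail -/

section Pieces

variable (q : ℕ) [NeZero q]

/-- The AFE box `1 ≤ nᵢ ≤ q²` (any box beyond `n₁n₂ ≤ q̂²(log q̂)^B` changes every piece by `O_A(q^{−A})`). -/
def afeBox : Finset ℕ := Icc 1 (q ^ 2)

/-- **The spectral sum of the mollified second moment against a PAIR KERNEL `κ(a, b)`** standing in for
`Σʰ_f λ_f(a)λ_f(b)`:
`Σ_{i,j ≤ deg Q} QᵢQⱼ ℓ^{−(i+j)} (1+(−1)^{i+j}) q̂ Σ_{n₁,n₂ ∈ box} (n₁n₂)^{−1/2} W_{ij}(q̂;n₁,n₂)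
 Σ_{m₁,m₂ ≤ M} x_{m₁}x_{m₂} Σ_{d₁ | (m₁,n₁)} Σ_{d₂ | (m₂,n₂)} κ(m₁n₁/d₁², m₂n₂/d₂²)`,
`ℓ = log q̂`, `x_m = KMV2000.mollifierCoeff P M m`, `M = q̂^{Δ'}` — i.e. AFE, then Hecke's recursion (10) pairing
`mᵢ` with `nᵢ` (KMV p. 13), then `κ` in place of the harmonic average. With `κ = Σʰλλ` this is `Σʰ Q̃Λ(f)² M_P(f)²`
up to the AFE truncation. -/
def spectralSum (P Q : ℝ[X]) (Δ' : ℝ) (κ : ℕ → ℕ → ℂ) : ℂ :=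
  ∑ i ∈ range (Q.natDegree + 1), ∑ j ∈ range (Q.natDegree + 1),
    (Q.coeff i : ℂ) * (Q.coeff j : ℂ) * (((Real.log (KMV2000.qhat q))⁻¹ : ℝ) : ℂ) ^ (i + j) *
      (1 + (-1 : ℂ) ^ (i + j)) * (KMV2000.qhat q : ℂ) *
    ∑ n₁ ∈ afeBox q, ∑ n₂ ∈ afeBox q,
      ((((n₁ : ℝ) * n₂) ^ (-(1 / 2 : ℝ)) : ℝ) : ℂ) * afeW (KMV2000.qhat q) i j n₁ n₂ *
      ∑ m₁ ∈ Icc 1 ⌊KMV2000.qhat q ^ Δ'⌋₊, ∑ m₂ ∈ Icc 1 ⌊KMV2000.qhat q ^ Δ'⌋₊,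
        (KMV2000.mollifierCoeff P (KMV2000.qhat q ^ Δ') m₁ : ℂ) *
          (KMV2000.mollifierCoeff P (KMV2000.qhat q ^ Δ') m₂ : ℂ) *
        ∑ d₁ ∈ (Nat.gcd m₁ n₁).divisors, ∑ d₂ ∈ (Nat.gcd m₂ n₂).divisors,
          κ (m₁ * n₁ / d₁ ^ 2) (m₂ * n₂ / d₂ ^ 2)

/-- The DIAGONAL kernel `δ(a, b)` of Petersson's formula (11). -/
def diagKernel : ℕ → ℕ → ℂ := fun a b ↦ if a = b then 1 else 0

/-- The LAYER-`r` kernel `(2π/q) · r⁻¹ S(a,b;qr) J₁(4π√(ab)/(qr))` — the modulus-`qr` term of `J(a,b) = petJ q a b`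
(Kowalski–Michel p. 312 / KMV (11)), via the tree's `KowalskiMichel2000.petKloostermanTerm`. -/
def layerKernel (r : ℕ) : ℕ → ℕ → ℂ :=
  fun a b ↦ (2 * (π : ℂ) / (q : ℂ)) * KowalskiMichel2000.petKloostermanTerm q a b r

/-- **D = the DIAGONAL PART** of the second display at `M = q̂^{Δ'}` (explicit; cusp-form-free). -/
def diagPart (P Q : ℝ[X]) (Δ' : ℝ) : ℂ := spectralSum q P Q Δ' diagKernel

/-- **K_r = the LAYER of Petersson modulus `c = q·r`** of the second display at `M = q̂^{Δ'}` (explicit; cusp-form-free;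
a finite bilinear-type sum of Kloosterman sums `S(m₁n₁/d₁², m₂n₂/d₂²; qr)` against Möbius coefficients and the
Bessel–Mellin weight). `r = 1` is the «c = q term» of barrier-notes BN-3/BN-7a. -/
def layer (P Q : ℝ[X]) (Δ' : ℝ) (r : ℕ) : ℂ := spectralSum q P Q Δ' (layerKernel q r)

/-- The number of layers kept in the heart: `R(q, Δ') = ⌊q̂^{ρ(Δ')}⌋`. -/
def layerCount (ρ : ℝ → ℝ) (Δ' : ℝ) : ℕ := ⌊KMV2000.qhat q ^ ρ Δ'⌋₊

/-- **HEART(ρ) = the first `⌊q̂^{ρ(Δ')}⌋` layers** `Σ_{1 ≤ r ≤ q̂^{ρ(Δ')}} K_r` (explicit; cusp-form-free). -/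
def heart (ρ : ℝ → ℝ) (P Q : ℝ[X]) (Δ' : ℝ) : ℂ :=
  ∑ r ∈ Icc 1 (layerCount q ρ Δ'), layer q P Q Δ' r

/-- **TAIL(ρ) := Q^h(P,Q)(q̂^{Δ'}) − D + HEART(ρ)** — DEFINED as the difference (so that the split is an identity);
by AFE (21) + Hecke (10) + Petersson (11) it equals `−Σ_{r > q̂^{ρ}} K_r` plus the AFE-truncation error. -/
def tail (ρ : ℝ → ℝ) (P Q : ℝ[X]) (Δ' : ℝ) : ℂ :=
  KMV2000.QhPQ q P Q (KMV2000.qhat q ^ Δ') - diagPart q P Q Δ' + heart q ρ P Q Δ'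

/-- **The layer split (an identity): `Q^h(P,Q)(q̂^{Δ'}) = D − HEART(ρ) + TAIL(ρ)`.** -/
theorem QhPQ_eq_layerSplit (ρ : ℝ → ℝ) (P Q : ℝ[X]) (Δ' : ℝ) :
    KMV2000.QhPQ q P Q (KMV2000.qhat q ^ Δ') = diagPart q P Q Δ' - heart q ρ P Q Δ' + tail q ρ P Q Δ' := by
  unfold tail
  ring

/-- The RUNG: the single layer `r = 1` (Petersson modulus `c = q`). -/
def rung (P Q : ℝ[X]) (Δ' : ℝ) : ℂ := layer q P Q Δ' 1

/-- The UPPER LAYERS `Σ_{2 ≤ r ≤ q̂^{ρ(Δ')}} K_r` (moduli `2q, 3q, …`; the Siegel-sensitive ones are `r ∈ Dℕ`). -/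
def upper (ρ : ℝ → ℝ) (P Q : ℝ[X]) (Δ' : ℝ) : ℂ :=
  ∑ r ∈ Icc 2 (layerCount q ρ Δ'), layer q P Q Δ' r

/-- `HEART(ρ) = RUNG + UPPER(ρ)` as soon as at least one layer is kept (`⌊q̂^{ρ(Δ')}⌋ ≥ 1`). -/
theorem heart_eq_rung_add_upper (ρ : ℝ → ℝ) (P Q : ℝ[X]) (Δ' : ℝ) (h : 1 ≤ layerCount q ρ Δ') :
    heart q ρ P Q Δ' = rung q P Q Δ' + upper q ρ P Q Δ' := by
  unfold heart rung upper
  have hIcc : Icc 1 (layerCount q ρ Δ') = insert 1 (Icc 2 (layerCount q ρ Δ')) := by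
    ext r
    simp only [mem_Icc, mem_insert]
    omega
  rw [hIcc, sum_insert (by simp)]

end Pieces

/-! ## §3. The piece statements -/

/-- A LEVEL FAMILY of second-moment-type quantities: `F q P Q Δ' ∈ ℂ` at each prime level `q`. -/
abbrev LevelFamily : Type := (q : ℕ) → [NeZero q] → ℝ[X] → ℝ[X] → ℝ → ℂ

/-- **`F` HAS AN ASYMPTOTIC OF THE SECOND-DISPLAY SHAPE on the window `(1, Δ]` with main-term functional `t`:**
same normalisation `2ζ(2)² q̂/(Δ'² log² q̂)`, same error budget `C q̂ (log q̂)⁻³`, same side condition `M ∉ ℕ` as the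
second display of `KMV2000.MomentAsymptotics` (and as deck 15's `PieceAsymptotics`). -/
def HasShape (F : LevelFamily) (Δ : ℝ) (t : ℝ → ℝ[X] → ℝ[X] → ℝ) : Prop :=
  ∀ P Q : ℝ[X], KMV2000.Admissible P → KMV2000.IsEvenOrOdd Q → ∀ Δ' : ℝ, 1 < Δ' → Δ' ≤ Δ →
    ∃ C : ℝ, ∃ q₀ : ℕ, ∀ (q : ℕ) [NeZero q], q.Prime → q₀ ≤ q →
      (∀ n : ℕ, (n : ℝ) ≠ KMV2000.qhat q ^ Δ') →
        ‖F q P Q Δ' -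
            ((2 * riemannZeta 2 ^ 2 *
                ((KMV2000.qhat q / (Δ' ^ 2 * Real.log (KMV2000.qhat q) ^ 2) : ℝ) : ℂ)) *
              ((t Δ' P Q : ℝ) : ℂ))‖ ≤
          C * KMV2000.qhat q * (Real.log (KMV2000.qhat q))⁻¹ ^ 3

/-- `F` has the second-display shape with SOME level-free main-term functional on SOME window beyond the diagonal. -/
def SubOf (F : LevelFamily) : Prop :=
  ∃ Δ : ℝ, 1 < Δ ∧ ∃ t : ℝ → ℝ[X] → ℝ[X] → ℝ, HasShape F Δ t

/-- **Sub_D (M/L):** the DIAGONAL PART `D` has an asymptotic of the printed shape beyond the diagonal — KMV's residue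
computation (23)–(28) with the constraint `m₁m₂ ≲ q̂²` now active (pairs with `m₁m₂ > q̂²` have no diagonal partner of
non-negligible weight), so `t_D ≠ secondMomentForm` continued: a Mellin exercise, no cancellation needed. -/
def SubDiag : Prop := SubOf (fun q _ P Q Δ' ↦ diagPart q P Q Δ')

/-- **Sub_H(ρ) (XL — the de-automorphised heart):** the first `q̂^{ρ(Δ')}` Petersson layers have an asymptotic of the
printed shape with SOME level-free functional `t_H` — square-root-beating cancellation in the μ∗μ-weighted bilinear
Kloosterman forms at the prime modulus `q` and its first multiples (barrier-notes BN-7a; (A)-sensitive through the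
layers `r ∈ Dℕ`). -/
def SubHeart (ρ : ℝ → ℝ) : Prop := SubOf (fun q _ P Q Δ' ↦ heart q ρ P Q Δ')

/-- **Sub_T(ρ) (M/L modulo the identification):** the tail `Q^h − D + HEART(ρ)` (= minus the layers `r > q̂^{ρ}` up to
the AFE truncation, by the three printed identities) has an asymptotic of the printed shape. ERRATUM (§5b): provable by
fixed-pair methods only from the Weil cut `ρ_W` on, where it is split as `TailNearFar ρ_W` (identification, L) +
`SubFar ρ_W` (explicit, M); the v1 gloss «layer-scaled Lemma 3.3, expected `t_T = 0` with a power saving» is retracted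
for every `ρ < 4Δ' − 2`. -/
def SubTail (ρ : ℝ → ℝ) : Prop := SubOf (fun q _ P Q Δ' ↦ tail q ρ P Q Δ')

/-- **Sub_R (XL, the RUNG of BN-7a (T4)):** the single layer `r = 1` (modulus `q`; `χ_D`-free, `ζ`-immune,
GRH(χ mod q)-feasible per KMV p. 28) has an asymptotic of the printed shape. -/
def SubRung : Prop := SubOf (fun q _ P Q Δ' ↦ rung q P Q Δ')

/-- **Sub_U(ρ) (XL⁺, the Siegel-sensitive remainder of the heart):** the layers `2 ≤ r ≤ q̂^{ρ(Δ')}`. -/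
def SubUpper (ρ : ℝ → ℝ) : Prop := SubOf (fun q _ P Q Δ' ↦ upper q ρ P Q Δ')

/-- **The v1 cut `ρ⋆(Δ') = 3(Δ' − 1)`** (kept as a checked instance; ERRATUM §5b: NOT a provable-tail cut — the
instance of record is the Weil cut `rhoWeil`): heart = layers `r ≤ q̂^{3(Δ'−1)} = q^{3(Δ'−1)/2}` ⊇ the oscillatory
layers `r ≲ q̂^{Δ'−1}`; negative (empty heart) iff `Δ' < 1`. -/
def rhoStar : ℝ → ℝ := fun Δ' ↦ 3 * (Δ' - 1)

/-- The v1 heart instance (at `ρ⋆`; superseded as instance of record by the Weil cut, §5b). -/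
def SubHeartStar : Prop := SubHeart rhoStar

/-- The v1 tail instance (at `ρ⋆`; superseded as instance of record by the Weil cut, §5b). -/
def SubTailStar : Prop := SubTail rhoStar

/-! ## §4. The glue (kernel-checked) -/

/-- `1 < q̂` for `q ≥ 64` (`√64/(2π) = 4/π > 1`). -/
theorem one_lt_qhat {q : ℕ} (hq : 64 ≤ q) : 1 < KMV2000.qhat q := by
  have hq64 : (64 : ℝ) ≤ q := by exact_mod_cast hq
  have hsq : (8 : ℝ) ≤ Real.sqrt q := by
    rw [show (8 : ℝ) = Real.sqrt 64 by
      rw [show (64 : ℝ) = 8 ^ 2 by norm_num, Real.sqrt_sq (by norm_num)]]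
    exact Real.sqrt_le_sqrt hq64
  have hπ : 0 < 2 * Real.pi := by positivity
  unfold KMV2000.qhat
  rw [lt_div_iff₀ hπ]
  linarith [Real.pi_lt_four]

/-- **GENERIC THREE-PIECE GLUE.** If level families `A, B, T` satisfy `Q^h(P,Q)(q̂^{Δ'}) = A − B + T` identically, then
`SubFirst → SubOf A → SubOf B → SubOf T → K_A` (intersect the four windows; `T₁` from `SubFirst`;
`T₂ := t_A − t_B + t_T − secondMomentForm`; triangle inequality; constants added). -/
theorem momentsBeyondDiagonal_of_three (A B T : LevelFamily)
    (hsplit : ∀ (q : ℕ) [NeZero q] (P Q : ℝ[X]) (Δ' : ℝ),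
      KMV2000.QhPQ q P Q (KMV2000.qhat q ^ Δ') = A q P Q Δ' - B q P Q Δ' + T q P Q Δ') :
    SubFirst → SubOf A → SubOf B → SubOf T → KA := by
  rintro ⟨Δ₁, h₁, T₁, H₁⟩ ⟨Δ₂, h₂, ta, H₂⟩ ⟨Δ₃, h₃, tb, H₃⟩ ⟨Δ₄, h₄, tt, H₄⟩
  show MomentsBeyondDiagonal
  refine ⟨min Δ₁ (min Δ₂ (min Δ₃ Δ₄)), lt_min h₁ (lt_min h₂ (lt_min h₃ h₄)), T₁,
    fun Δ' P Q ↦ ta Δ' P Q - tb Δ' P Q + tt Δ' P Q - KMV2000.secondMomentForm Δ' P Q, ?_⟩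
  intro P Q hP hQ Δ hlo hhi
  have hΔ₁ : Δ ≤ Δ₁ := hhi.trans (min_le_left _ _)
  have hΔ₂ : Δ ≤ Δ₂ := hhi.trans ((min_le_right _ _).trans (min_le_left _ _))
  have hΔ₃ : Δ ≤ Δ₃ := hhi.trans ((min_le_right _ _).trans ((min_le_right _ _).trans (min_le_left _ _)))
  have hΔ₄ : Δ ≤ Δ₄ := hhi.trans ((min_le_right _ _).trans ((min_le_right _ _).trans (min_le_right _ _)))
  obtain ⟨C₁, q₁, HH₁⟩ := H₁ P Q hP hQ Δ hlo hΔ₁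
  obtain ⟨C₂, q₂, HH₂⟩ := H₂ P Q hP hQ Δ hlo hΔ₂
  obtain ⟨C₃, q₃, HH₃⟩ := H₃ P Q hP hQ Δ hlo hΔ₃
  obtain ⟨C₄, q₄, HH₄⟩ := H₄ P Q hP hQ Δ hlo hΔ₄
  refine ⟨max C₁ (C₂ + C₃ + C₄), max (max (max q₁ q₂) (max q₃ q₄)) 64, fun q _ hq hq₀ hM ↦ ⟨?_, ?_⟩⟩
  · have hq₁ : q₁ ≤ q := le_trans (le_max_left _ _) (le_trans (le_max_left _ _) (le_trans (le_max_left _ _) hq₀))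
    have h := HH₁ q hq hq₁ hM
    exact h.trans (mul_le_mul_of_nonneg_right
      (mul_le_mul_of_nonneg_right (le_max_left _ _) (Real.sqrt_nonneg _)) (sq_nonneg _))
  · have hq₂ : q₂ ≤ q := le_trans (le_max_right _ _) (le_trans (le_max_left _ _) (le_trans (le_max_left _ _) hq₀))
    have hq₃ : q₃ ≤ q := le_trans (le_max_left _ _) (le_trans (le_max_right _ _) (le_trans (le_max_left _ _) hq₀))
    have hq₄ : q₄ ≤ q := le_trans (le_max_right _ _) (le_trans (le_max_right _ _) (le_trans (le_max_left _ _) hq₀))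
    have ha := HH₂ q hq hq₂ hM
    have hb := HH₃ q hq hq₃ hM
    have ht := HH₄ q hq hq₄ hM
    have hq1 : 1 ≤ KMV2000.qhat q := (one_lt_qhat (le_trans (le_max_right _ _) hq₀)).le
    have hq' : 0 ≤ KMV2000.qhat q := zero_le_one.trans hq1
    have hlog : 0 ≤ (Real.log (KMV2000.qhat q))⁻¹ := inv_nonneg.mpr (Real.log_nonneg hq1)
    have hX : 0 ≤ KMV2000.qhat q * (Real.log (KMV2000.qhat q))⁻¹ ^ 3 := mul_nonneg hq' (pow_nonneg hlog 3)
    rw [hsplit q P Q Δ]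
    set N₂ : ℂ := (2 * riemannZeta 2 ^ 2 *
        ((KMV2000.qhat q / (Δ ^ 2 * Real.log (KMV2000.qhat q) ^ 2) : ℝ) : ℂ)) with hN₂
    have e : A q P Q Δ - B q P Q Δ + T q P Q Δ -
          N₂ * ((KMV2000.secondMomentForm Δ P Q +
              (ta Δ P Q - tb Δ P Q + tt Δ P Q - KMV2000.secondMomentForm Δ P Q) : ℝ) : ℂ) =
        (A q P Q Δ - N₂ * ((ta Δ P Q : ℝ) : ℂ)) - (B q P Q Δ - N₂ * ((tb Δ P Q : ℝ) : ℂ)) +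
          (T q P Q Δ - N₂ * ((tt Δ P Q : ℝ) : ℂ)) := by
      push_cast
      ring
    rw [e]
    calc ‖(A q P Q Δ - N₂ * ((ta Δ P Q : ℝ) : ℂ)) - (B q P Q Δ - N₂ * ((tb Δ P Q : ℝ) : ℂ)) +
            (T q P Q Δ - N₂ * ((tt Δ P Q : ℝ) : ℂ))‖
        ≤ ‖(A q P Q Δ - N₂ * ((ta Δ P Q : ℝ) : ℂ)) - (B q P Q Δ - N₂ * ((tb Δ P Q : ℝ) : ℂ))‖ +
            ‖T q P Q Δ - N₂ * ((tt Δ P Q : ℝ) : ℂ)‖ := norm_add_le _ _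
      _ ≤ (‖A q P Q Δ - N₂ * ((ta Δ P Q : ℝ) : ℂ)‖ + ‖B q P Q Δ - N₂ * ((tb Δ P Q : ℝ) : ℂ)‖) +
            ‖T q P Q Δ - N₂ * ((tt Δ P Q : ℝ) : ℂ)‖ := by
          gcongr
          exact norm_sub_le _ _
      _ ≤ (C₂ * KMV2000.qhat q * (Real.log (KMV2000.qhat q))⁻¹ ^ 3 +
            C₃ * KMV2000.qhat q * (Real.log (KMV2000.qhat q))⁻¹ ^ 3) +
            C₄ * KMV2000.qhat q * (Real.log (KMV2000.qhat q))⁻¹ ^ 3 := add_le_add (add_le_add ha hb) ht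
      _ = (C₂ + C₃ + C₄) * (KMV2000.qhat q * (Real.log (KMV2000.qhat q))⁻¹ ^ 3) := by ring
      _ ≤ max C₁ (C₂ + C₃ + C₄) * (KMV2000.qhat q * (Real.log (KMV2000.qhat q))⁻¹ ^ 3) :=
          mul_le_mul_of_nonneg_right (le_max_right _ _) hX
      _ = max C₁ (C₂ + C₃ + C₄) * KMV2000.qhat q * (Real.log (KMV2000.qhat q))⁻¹ ^ 3 := by ring

/-- **GLUE (proved, every layer cut `ρ`): `SubFirst → SubDiag → SubHeart ρ → SubTail ρ → K_A`.** -/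
theorem MomentsBeyondDiagonal_of_layerSplit (ρ : ℝ → ℝ) :
    SubFirst → SubDiag → SubHeart ρ → SubTail ρ → KA :=
  momentsBeyondDiagonal_of_three
    (fun q _ P Q Δ' ↦ diagPart q P Q Δ') (fun q _ P Q Δ' ↦ heart q ρ P Q Δ') (fun q _ P Q Δ' ↦ tail q ρ P Q Δ')
    (fun q _ P Q Δ' ↦ QhPQ_eq_layerSplit q ρ P Q Δ')

/-- **The v1 instance (proved): `SubFirst → SubDiag → SubHeart⋆ → SubTail⋆ → K_A`** at `ρ⋆(Δ') = 3(Δ'−1)` (instance of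
record since §5b: `MomentsBeyondDiagonal_of_sixSplitWeil`). -/
theorem MomentsBeyondDiagonal_of_layerSplitStar :
    SubFirst → SubDiag → SubHeartStar → SubTailStar → KA :=
  MomentsBeyondDiagonal_of_layerSplit rhoStar

end Summit.Parity.GeneralizedHardyLittlewood.Theorems.PrimeLevelFamEdgeIdeaDeltas.PeterssonLayers

end
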